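import Literature.NumberTheory.LFunctions.WeilMarkovQuadratic
import Literature.NumberTheory.LFunctions.WeilWindowSuzukiProofs
import HarnessLib

/-!
# RiemannHypothesis / GroundBarta — crux `PolarPerronFrobenius` (stmt-RiemannHypothesis-18390):
# the EVEN-SECTOR kernel inequality for sign improvement at windows `a ≤ 1/4` (part E1/3)

Helper file (`--supports stmt-RiemannHypothesis-18390`), RH-free, Mathlib + proved Literature files
only, no definitions, no named facts.

The small-window Perron–Frobenius theorem of this crux (`…SignImproving.lean`, `…SmallWindows.lean`:
`Re Q(|f|) ≤ Re Q(f)` for real window tests, hence cone density and `GSP a`, for `0 < a ≤ 1/10`)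
compares the Beurling–Deny gain of the Markov part, kernel `w(|x−y|)` (`w = weilArchDensity`,
`w(t) = e^{t/2}/(2 sinh t)`), with the polar loss, kernel `2cosh((x−y)/2)`, POINTWISE in the
separation `|x − y| ≤ 2a`; the threshold is `2cosh a ≤ w(2a)`, `a ≤ 0.1406…`, and it is sharp for
general real tests (barrier file `…SignImprovingBarrier.lean`, `a ≥ 3/10`).  In the EVEN sector —
the sector of the registered RH-bearing stub `stub_evenConeDense_cofinal` — the positive and the
negative part of an even `f` are even, the bilinear defect symmetrises under `y ↦ −y`, and the
relevant pointwise inequality becomes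

  `w(|x−y|) + w(|x+y|) ≥ 2cosh((x−y)/2) + 2cosh((x+y)/2) = 4cosh(x/2)cosh(y/2)`, `x, y ∈ [-a, a]`,

whose threshold is `w(a) ≥ 1 + cosh a`, i.e. `a ≤ 0.277…` — twice the parity-free range.  This
file proves the kernel inequality for `a ≤ 1/4` (with the gain kernel truncated at height `5`, which
is what the dominated-convergence argument of part E2 uses):

* `swe_weilArchDensity_hasSum`: `w(t) = Σ_k e^{-(2k+1/2)t}` (`t > 0`), hence
  `swe_weilArchDensity_midpoint`: **`w` is midpoint-convex** on `(0, ∞)`,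
  `w(s) + w(t) ≥ 2 w((s+t)/2)` (termwise AM–GM);
* `swe_cosh_half_add_le`: `cosh(s/2) + cosh(t/2) ≤ 1 + cosh a` for `s, t ≥ 0`, `s + t ≤ 2a`;
* `swe_one_add_cosh_le_weilArchDensity`: `1 + cosh a ≤ w(a)` for `0 < a ≤ 1/4` (numerics at `1/4`);
* `swe_kernel_ge`: for `0 < s`, `0 < t`, `s + t ≤ 2a ≤ 1/2`,
  `2cosh(s/2) + 2cosh(t/2) ≤ min (w s) 5 + min (w t) 5`.

Prover B, speedrun unit `sr-gb-rung-b` (seat 2).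
-/

set_option linter.dupNamespace false

noncomputable section

open Set MeasureTheory Filter Complex
open scoped Real Topology

namespace Summit.RiemannHypothesis.RiemannHypothesis.Theorems.PolarPerronFrobenius

open Literature.NumberTheory.LFunctions

/-! ## `w` as a series of exponentials; midpoint convexity -/

/-- **`w(t) = Σ_{k ≥ 0} e^{-(2k + 1/2)t}`** for `t > 0` (`w(t) = e^{-t/2}/(1 − e^{-2t})`, geometric
series). [folklore] -/
theorem swe_weilArchDensity_hasSum {t : ℝ} (ht : 0 < t) :
    HasSum (fun k : ℕ ↦ Real.exp (-((2 * k + 1 / 2) * t))) (weilArchDensity t) := by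
  have hr0 : 0 ≤ Real.exp (-(2 * t)) := (Real.exp_pos _).le
  have hr1 : Real.exp (-(2 * t)) < 1 := Real.exp_lt_one_iff.2 (by linarith)
  have hgeom := (hasSum_geometric_of_lt_one hr0 hr1).mul_left (Real.exp (-(t / 2)))
  have hterm : ∀ k : ℕ, Real.exp (-(t / 2)) * Real.exp (-(2 * t)) ^ k =
      Real.exp (-((2 * k + 1 / 2) * t)) := by
    intro k
    rw [← Real.exp_nat_mul, ← Real.exp_add]
    congr 1
    ring
  have hval : Real.exp (-(t / 2)) * (1 - Real.exp (-(2 * t)))⁻¹ = weilArchDensity t := by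
    have hs : 0 < 2 * Real.sinh t := mul_pos two_pos (Real.sinh_pos_iff.2 ht)
    have hden : 0 < 1 - Real.exp (-(2 * t)) := by linarith
    unfold weilArchDensity
    rw [← div_eq_mul_inv, div_eq_div_iff hden.ne' hs.ne']
    have e1 : Real.exp (-(t / 2)) * Real.exp t = Real.exp (t / 2) := by
      rw [← Real.exp_add]; congr 1; ring
    have e2 : Real.exp (-(t / 2)) * Real.exp (-t) = Real.exp (t / 2) * Real.exp (-(2 * t)) := by
      rw [← Real.exp_add, ← Real.exp_add]; congr 1; ring
    calc Real.exp (-(t / 2)) * (2 * Real.sinh t)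
        = Real.exp (-(t / 2)) * Real.exp t - Real.exp (-(t / 2)) * Real.exp (-t) := by
          rw [Real.sinh_eq]; ring
      _ = Real.exp (t / 2) * (1 - Real.exp (-(2 * t))) := by rw [e1, e2]; ring
  simp_rw [hterm] at hgeom
  rwa [hval] at hgeom

/-- AM–GM for exponentials: `2 e^{(u+v)/2} ≤ e^u + e^v`. [folklore] -/
theorem swe_two_mul_exp_half_add_le (u v : ℝ) :
    2 * Real.exp ((u + v) / 2) ≤ Real.exp u + Real.exp v := by
  have hu : Real.exp u = Real.exp (u / 2) ^ 2 := by
    rw [sq, ← Real.exp_add]; congr 1; ring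
  have hv : Real.exp v = Real.exp (v / 2) ^ 2 := by
    rw [sq, ← Real.exp_add]; congr 1; ring
  have hm : Real.exp ((u + v) / 2) = Real.exp (u / 2) * Real.exp (v / 2) := by
    rw [← Real.exp_add]; congr 1; ring
  rw [hu, hv, hm]
  nlinarith [sq_nonneg (Real.exp (u / 2) - Real.exp (v / 2))]

/-- **Midpoint convexity of `w` on `(0, ∞)`**: `2 w((s+t)/2) ≤ w(s) + w(t)` (termwise AM–GM in
the exponential series). [folklore] -/
theorem swe_weilArchDensity_midpoint {s t : ℝ} (hs : 0 < s) (ht : 0 < t) :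
    2 * weilArchDensity ((s + t) / 2) ≤ weilArchDensity s + weilArchDensity t := by
  have hm : 0 < (s + t) / 2 := by linarith
  have h1 := (swe_weilArchDensity_hasSum hs).add (swe_weilArchDensity_hasSum ht)
  have h2 := (swe_weilArchDensity_hasSum hm).mul_left 2
  refine hasSum_le (fun k ↦ ?_) h2 h1
  have h := swe_two_mul_exp_half_add_le (-((2 * k + 1 / 2) * s)) (-((2 * k + 1 / 2) * t))
  have e : (-((2 * (k : ℝ) + 1 / 2) * s) + -((2 * k + 1 / 2) * t)) / 2 =
      -((2 * k + 1 / 2) * ((s + t) / 2)) := by ring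
  rwa [e] at h

/-! ## The hyperbolic side: `cosh(s/2) + cosh(t/2) ≤ 1 + cosh a` on `s + t ≤ 2a` -/

/-- `cosh A + cosh B = 2 cosh((A+B)/2) cosh((A−B)/2)`. [folklore] -/
theorem swe_cosh_add_cosh (A B : ℝ) :
    Real.cosh A + Real.cosh B = 2 * Real.cosh ((A + B) / 2) * Real.cosh ((A - B) / 2) := by
  have h1 := Real.cosh_add ((A + B) / 2) ((A - B) / 2)
  have h2 := Real.cosh_sub ((A + B) / 2) ((A - B) / 2)
  have eA : (A + B) / 2 + (A - B) / 2 = A := by ring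
  have eB : (A + B) / 2 - (A - B) / 2 = B := by ring
  rw [eA] at h1
  rw [eB] at h2
  rw [h1, h2]
  ring

/-- `2 cosh² u = 1 + cosh 2u`. [folklore] -/
theorem swe_two_mul_cosh_sq (u : ℝ) : 2 * Real.cosh u ^ 2 = 1 + Real.cosh (2 * u) := by
  rw [Real.cosh_two_mul, Real.cosh_sq]
  ring

/-- **`cosh(s/2) + cosh(t/2) ≤ 1 + cosh a`** for `0 ≤ s`, `0 ≤ t`, `s + t ≤ 2a`
(`= 2cosh((s+t)/4)cosh((s−t)/4) ≤ 2cosh²((s+t)/4) = 1 + cosh((s+t)/2)`). [folklore] -/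
theorem swe_cosh_half_add_le {s t a : ℝ} (hs : 0 ≤ s) (ht : 0 ≤ t) (hst : s + t ≤ 2 * a) :
    Real.cosh (s / 2) + Real.cosh (t / 2) ≤ 1 + Real.cosh a := by
  rw [swe_cosh_add_cosh]
  have e1 : (s / 2 + t / 2) / 2 = (s + t) / 4 := by ring
  have e2 : (s / 2 - t / 2) / 2 = (s - t) / 4 := by ring
  rw [e1, e2]
  have hc0 : 0 < Real.cosh ((s + t) / 4) := Real.cosh_pos _
  have hle1 : Real.cosh ((s - t) / 4) ≤ Real.cosh ((s + t) / 4) := by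
    rw [Real.cosh_le_cosh, abs_le, abs_of_nonneg (by linarith : 0 ≤ (s + t) / 4)]
    constructor <;> linarith
  have hle2 : Real.cosh ((s + t) / 2) ≤ Real.cosh a := by
    rw [Real.cosh_le_cosh, abs_of_nonneg (by linarith : 0 ≤ (s + t) / 2),
      abs_of_nonneg (by linarith : 0 ≤ a)]
    linarith
  calc 2 * Real.cosh ((s + t) / 4) * Real.cosh ((s - t) / 4)
      ≤ 2 * Real.cosh ((s + t) / 4) * Real.cosh ((s + t) / 4) :=
        mul_le_mul_of_nonneg_left hle1 (by positivity)
    _ = 1 + Real.cosh (2 * ((s + t) / 4)) := by rw [← swe_two_mul_cosh_sq]; ring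
    _ = 1 + Real.cosh ((s + t) / 2) := by congr 1; ring_nf
    _ ≤ 1 + Real.cosh a := by linarith

/-! ## Numerics at `a = 1/4`: `1 + cosh(1/4) ≤ 21/10 < 11/5 ≤ w(1/4)` -/

/-- `e^{1/4} ≤ 1.2841` (`1.2841⁴ > e`). [folklore] -/
theorem swe_exp_quarter_le : Real.exp (1 / 4) ≤ 1.2841 := by
  have h4 : Real.exp (1 / 4) ^ 4 = Real.exp 1 := by
    rw [← Real.exp_nat_mul]; norm_num
  have h1 : Real.exp 1 < 2.7182818286 := Real.exp_one_lt_d9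
  by_contra h
  have h'' : (1.2841 : ℝ) < Real.exp (1 / 4) := lt_of_not_ge h
  have h' : (1.2841 : ℝ) ^ 4 < Real.exp (1 / 4) ^ 4 := by gcongr
  rw [h4] at h'
  norm_num at h'
  linarith

/-- `0.7787 ≤ e^{-1/4}`. [folklore] -/
theorem swe_exp_neg_quarter_ge : 0.7787 ≤ Real.exp (-(1 / 4)) := by
  have h := swe_exp_quarter_le
  have hpos := Real.exp_pos (1 / 4)
  rw [Real.exp_neg]
  rw [show (0.7787 : ℝ) = (0.7787⁻¹)⁻¹ by norm_num]
  exact inv_anti₀ hpos (h.trans (by norm_num))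

/-- `e^{-1/4} ≤ 0.7805` (`e^{1/4} ≥ 1 + 1/4 + 1/32`). [folklore] -/
theorem swe_exp_neg_quarter_le : Real.exp (-(1 / 4)) ≤ 0.7805 := by
  have h : (1 : ℝ) + 1 / 4 + (1 / 4) ^ 2 / 2 ≤ Real.exp (1 / 4) :=
    Real.quadratic_le_exp_of_nonneg (by norm_num)
  have hpos := Real.exp_pos (1 / 4)
  rw [Real.exp_neg]
  calc (Real.exp (1 / 4))⁻¹ ≤ ((1 : ℝ) + 1 / 4 + (1 / 4) ^ 2 / 2)⁻¹ := inv_anti₀ (by norm_num) h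
    _ ≤ 0.7805 := by norm_num

/-- `1 + cosh(1/4) ≤ 21/10`. [folklore] -/
theorem swe_one_add_cosh_quarter_le : 1 + Real.cosh (1 / 4) ≤ 21 / 10 := by
  rw [Real.cosh_eq]
  linarith [swe_exp_quarter_le, swe_exp_neg_quarter_le]

/-- `11/5 ≤ w(1/4)` (`e^{1/8} ≥ 1 + 1/8`, `sinh(1/4) ≤ (1.2841 − 0.7787)/2`). [folklore] -/
theorem swe_weilArchDensity_quarter_ge : 11 / 5 ≤ weilArchDensity (1 / 4) := by
  have hs : Real.sinh (1 / 4) ≤ 0.2527 := by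
    rw [Real.sinh_eq]
    linarith [swe_exp_quarter_le, swe_exp_neg_quarter_ge]
  have hs0 : 0 < Real.sinh (1 / 4) := Real.sinh_pos_iff.2 (by norm_num)
  have he : (1 : ℝ) + 1 / 8 ≤ Real.exp (1 / 4 / 2) := by
    have := Real.add_one_le_exp (1 / 4 / 2 : ℝ)
    linarith
  unfold weilArchDensity
  rw [le_div_iff₀ (by positivity)]
  nlinarith

/-- **The even-sector window threshold at `a ≤ 1/4`**: `1 + cosh a ≤ w(a)` for `0 < a ≤ 1/4`
(`w` is non-increasing, `cosh` non-decreasing on `[0, ∞)`; numerics at `1/4`; the true threshold of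
`1 + cosh a ≤ w(a)` is `a ≤ 0.277…`). [folklore] -/
theorem swe_one_add_cosh_le_weilArchDensity {a : ℝ} (ha : 0 < a) (ha' : a ≤ 1 / 4) :
    1 + Real.cosh a ≤ weilArchDensity a := by
  have h1 : Real.cosh a ≤ Real.cosh (1 / 4) := by
    rw [Real.cosh_le_cosh, abs_of_pos ha, abs_of_pos (by norm_num : (0 : ℝ) < 1 / 4)]
    exact ha'
  have h2 : weilArchDensity (1 / 4) ≤ weilArchDensity a :=
    weilArchDensity_antitoneOn (mem_Ioi.2 ha) (mem_Ioi.2 (by norm_num)) ha'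
  linarith [swe_one_add_cosh_quarter_le, swe_weilArchDensity_quarter_ge]

/-! ## The kernel inequality -/

/-- **The even-sector kernel inequality (truncated gain kernel).**  For `0 < s`, `0 < t` with
`s + t ≤ 2a`, `0 < a ≤ 1/4`:
`2cosh(s/2) + 2cosh(t/2) ≤ min (w s) 5 + min (w t) 5`.
(If one of `w s`, `w t` is `≥ 5`: the right side is `≥ 5 ≥ 2(1 + cosh a)`.  Otherwise
`w s + w t ≥ 2w((s+t)/2) ≥ 2w(a) ≥ 2(1 + cosh a) ≥ 2cosh(s/2) + 2cosh(t/2)`.)  Applied with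
`s = |x − y|`, `t = |x + y|` (`s + t = 2 max(|x|,|y|)`), this is
`w(|x−y|) ∧ 5 + w(|x+y|) ∧ 5 ≥ 4cosh(x/2)cosh(y/2)` on `[-a, a]²` off the diagonals. [folklore] -/
theorem swe_kernel_ge {s t a : ℝ} (hs : 0 < s) (ht : 0 < t) (ha : 0 < a) (ha' : a ≤ 1 / 4)
    (hst : s + t ≤ 2 * a) :
    2 * Real.cosh (s / 2) + 2 * Real.cosh (t / 2) ≤ min (weilArchDensity s) 5 + min (weilArchDensity t) 5 := by
  have hcosh := swe_cosh_half_add_le hs.le ht.le hst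
  have hthr := swe_one_add_cosh_le_weilArchDensity ha ha'
  have hca : 1 + Real.cosh a ≤ 21 / 10 := by
    have h1 : Real.cosh a ≤ Real.cosh (1 / 4) := by
      rw [Real.cosh_le_cosh, abs_of_pos ha, abs_of_pos (by norm_num : (0 : ℝ) < 1 / 4)]
      exact ha'
    linarith [swe_one_add_cosh_quarter_le]
  have hws0 : 0 ≤ weilArchDensity s := (weilArchDensity_pos hs).le
  have hwt0 : 0 ≤ weilArchDensity t := (weilArchDensity_pos ht).le
  by_cases h5s : 5 ≤ weilArchDensity s
  · rw [min_eq_right h5s]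
    have : 0 ≤ min (weilArchDensity t) 5 := le_min hwt0 (by norm_num)
    linarith
  by_cases h5t : 5 ≤ weilArchDensity t
  · rw [min_eq_right h5t]
    have : 0 ≤ min (weilArchDensity s) 5 := le_min hws0 (by norm_num)
    linarith
  rw [min_eq_left (le_of_not_ge h5s), min_eq_left (le_of_not_ge h5t)]
  have hmid := swe_weilArchDensity_midpoint hs ht
  have hm0 : 0 < (s + t) / 2 := by linarith
  have hanti : weilArchDensity a ≤ weilArchDensity ((s + t) / 2) :=
    weilArchDensity_antitoneOn (mem_Ioi.2 hm0) (mem_Ioi.2 ha) (by linarith)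
  linarith

end Summit.RiemannHypothesis.RiemannHypothesis.Theorems.PolarPerronFrobenius

end
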